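import Mathlib
import Literature.Probability.LatticeModels.ProdBernoulliIndependence
import Summits.CriticalPhenomena.PercolationContinuityZ3.Theses.PercNearOneGluing
import Summits.CriticalPhenomena.PercolationContinuityZ3.Theorems.PercNearOneGluingNearOneGluingSprinkled
import Summits.CriticalPhenomena.PercolationContinuityZ3.Theorems.PercNearOneGluingNearOneGluingFewWeakFingers
import HarnessLib

/-!
# Crux skeleton — `PercNearOneGluing.NearOneGluing` (stmt-CriticalPhenomena-4574),
# line `live-seal-vanishing-sprinkle` (lead a1, cycle 2 rebuild)

Kozma–Nitzan Conjecture 3 over finite weighted graphs.  Objects: one weighted graph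
(`Fin n`, `w`, `μ = prodBernoulli w`), relays `A`, source `o ∉ A`, target `b`;
bad `= {o ↮ b} ∩ {o ↔ A}`; `P ω` = relay-free pocket of `o` (`v ∈ P ω ↔ o ↔ v` inside `(↑A)ᶜ`);
`L T ω` = live boundary pairs of `T` towards `b` (`s(x,y)`, `x ∈ T`, `y ∉ T`, `y ↔ b` inside `(↑T)ᶜ`);
`κ(ω) = ∏_{e ∈ L (P ω) ω} (1 - w e)` = prior closure probability of the live seal.

Composition (`NearOneGluing_of`):
`{o ↮ b} ⊆ {o ↮ A} ∪ (bad ∧ |P| ≤ K) ∪ (bad ∧ θ ≤ κ) ∪ (bad ∧ κ < θ ∧ K < |P|)` with costs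
`δ` (hypothesis), `√δ · D_K` (LANDED `Theorems.stub_smallPockets`, p93036, at `s = 1/2`),
`δ/θ` (LANDED K1 `Theorems.liveSeal_exposureBound`, p90044 ← p86129 p86143), `ε/4` (the residual
`stub_exposedLargePocketsRare`, the ONLY `sorry`).  Also landed and available to the residual:
`Theorems.stub_fewWeakFingers` (p92950: off mass `Õ(η)` a strong anchor is attached or `> m` relays
hang dead on the pocket), `Theorems.sprinkledNearOneGluing` (K1′, p90044), `Theorems.smallPockets_term_le`.

The residual is crux-EQUIVALENT given the landed pieces (`exposedLargePocketsRare_of_nearOneGluing`).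
-/

namespace Summit.CriticalPhenomena.PercolationContinuityZ3.Cruxes.NearOneGluing.LiveSeal

open scoped BigOperators Classical
open MeasureTheory Set
open Literature.Probability.LatticeModels (prodBernoulli)
open Literature.Probability.Percolation (openConn openConnIn)
open Summit.CriticalPhenomena.PercolationContinuityZ3.Theses.PercNearOneGluing (NearOneGluing)

/-- **Residual stub (the line's only open obligation).** Exposed (`κ < θ`) bad configurations with a
LARGE relay-free pocket (`K < |P ω|`) have mass `≤ ε` once both hypotheses hold at a level `δ(ε)`;
`θ` and `K` are chosen first (as functions of `ε` only).  Crux-equivalent given K1 and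
`stub_smallPockets` (see `exposedLargePocketsRare_of_nearOneGluing`). -/
theorem stub_exposedLargePocketsRare : ∀ ε : ℝ, 0 < ε → ∃ θ : ℝ, 0 < θ ∧ ∃ K : ℕ, ∃ δ : ℝ, 0 < δ ∧ ∀ (n : ℕ) (w : Sym2 (Fin n) → unitInterval) (A : Finset (Fin n)) (o b : Fin n), o ∉ A → ∀ (P : Set (Sym2 (Fin n)) → Finset (Fin n)) (L : Finset (Fin n) → Set (Sym2 (Fin n)) → Finset (Sym2 (Fin n))), (∀ ω v, v ∈ P ω ↔ ω ∈ openConnIn ((↑A : Set (Fin n))ᶜ) o v) → (∀ T ω e, e ∈ L T ω ↔ ∃ x ∈ T, ∃ y ∉ T, e = s(x, y) ∧ ω ∈ openConnIn ((↑T : Set (Fin n))ᶜ) y b) → (prodBernoulli w).real (⋃ a ∈ A, openConn o a)ᶜ ≤ δ → (∀ a ∈ A, (prodBernoulli w).real (openConn a b)ᶜ ≤ δ) → (prodBernoulli w).real {ω | ω ∉ openConn o b ∧ (∃ a ∈ A, ω ∈ openConn o a) ∧ ∏ e ∈ L (P ω) ω, (1 - (w e : ℝ)) < θ ∧ K < (P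 ω).card} ≤ ε := by
  sorry

/-- **Stub `stub_smallPockets` (LANDED as `Theorems.stub_smallPockets`, p93036; restated here verbatim with
`sorry` only until the hub has built that module's olean — then this block is replaced by the import).**
Small relay-free pockets are harmless: `μ{bad ∧ |P ω| = k} ≤ t^s (1-s)^{-(k-1)} k^k`. -/
theorem stub_smallPockets (n : ℕ) (w : Sym2 (Fin n) → unitInterval) (A : Finset (Fin n))
    (o b : Fin n) (ho : o ∉ A) (t s : ℝ) (ht : 0 ≤ t) (hs0 : 0 < s) (hs1 : s < 1) (k : ℕ)
    (hrel : ∀ a ∈ A, (prodBernoulli w).real (openConn a b)ᶜ ≤ t)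
    (P : Set (Sym2 (Fin n)) → Finset (Fin n))
    (hP : ∀ ω v, v ∈ P ω ↔ ω ∈ openConnIn ((↑A : Set (Fin n))ᶜ) o v) :
    (prodBernoulli w).real {ω | ω ∉ openConn o b ∧ (∃ a ∈ A, ω ∈ openConn o a) ∧
        (P ω).card = k} ≤ t ^ s / (1 - s) ^ (k - 1) * (k : ℝ) ^ k := by
  sorry

/-- The pocket selector used in the composition: `P ω = {v | o ↔ v inside (↑A)ᶜ}`. -/
noncomputable def pocketSel {n : ℕ} (A : Finset (Fin n)) (o : Fin n) (ω : Set (Sym2 (Fin n))) :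
    Finset (Fin n) :=
  Finset.univ.filter fun v => ω ∈ openConnIn ((↑A : Set (Fin n))ᶜ) o v

/-- The live-pair selector: `L T ω = {s(x,y) | x ∈ T, y ∉ T, y ↔ b inside (↑T)ᶜ}`. -/
noncomputable def liveSel {n : ℕ} (b : Fin n) (T : Finset (Fin n)) (ω : Set (Sym2 (Fin n))) :
    Finset (Sym2 (Fin n)) :=
  Finset.univ.filter fun e : Sym2 (Fin n) =>
    ∃ x ∈ T, ∃ y ∉ T, e = s(x, y) ∧ ω ∈ openConnIn ((↑T : Set (Fin n))ᶜ) y b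

theorem mem_pocketSel {n : ℕ} (A : Finset (Fin n)) (o : Fin n) :
    ∀ ω v, v ∈ pocketSel A o ω ↔ ω ∈ openConnIn ((↑A : Set (Fin n))ᶜ) o v := by
  intro ω v; simp [pocketSel]

theorem mem_liveSel {n : ℕ} (b : Fin n) :
    ∀ T ω e, e ∈ liveSel b T ω ↔
      ∃ x ∈ T, ∃ y ∉ T, e = s(x, y) ∧ ω ∈ openConnIn ((↑T : Set (Fin n))ᶜ) y b := by
  intro T ω e; simp [liveSel]

/-- **Composition: the residual stub closes the crux.**  `NearOneGluing` from the landed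
`Theorems.liveSeal_exposureBound` (K1), `Theorems.stub_smallPockets` (at `s = 1/2`) and the
residual `stub_exposedLargePocketsRare`. -/
theorem NearOneGluing_of : NearOneGluing := by
  intro ε hε
  obtain ⟨θ, hθ, K, δ₁, hδ₁, hres⟩ := stub_exposedLargePocketsRare (ε / 4) (by positivity)
  -- the small-pocket constant
  set D : ℝ := ∑ k ∈ Finset.range (K + 1), 1 / ((1 : ℝ) / 2) ^ (k - 1) * (k : ℝ) ^ k with hD
  have hD0 : 0 ≤ D := Finset.sum_nonneg fun k _ => by positivity
  set c : ℝ := ε / (8 * (D + 1)) with hc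
  have hc0 : 0 < c := by positivity
  refine ⟨min δ₁ (min (ε / 8) (min (θ * ε / 8) (c ^ 2))), ?_, ?_⟩
  · positivity
  intro n w A o b hoA hrel
  set δ : ℝ := min δ₁ (min (ε / 8) (min (θ * ε / 8) (c ^ 2))) with hδdef
  have hδ1 : δ ≤ δ₁ := min_le_left _ _
  have hδ2 : δ ≤ ε / 8 := (min_le_right _ _).trans (min_le_left _ _)
  have hδ3 : δ ≤ θ * ε / 8 := ((min_le_right _ _).trans (min_le_right _ _)).trans (min_le_left _ _)
  have hδ4 : δ ≤ c ^ 2 := ((min_le_right _ _).trans (min_le_right _ _)).trans (min_le_right _ _)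
  have hδ0 : 0 ≤ δ := by positivity
  set μ := prodBernoulli w with hμ
  -- hypotheses in complement form
  have hoA' : μ.real (⋃ a ∈ A, openConn o a)ᶜ ≤ δ := by
    rw [probReal_compl_eq_one_sub MeasurableSet.of_discrete]; linarith
  have hrel' : ∀ a ∈ A, μ.real (openConn a b)ᶜ ≤ δ := by
    intro a ha
    rw [probReal_compl_eq_one_sub MeasurableSet.of_discrete]
    have := hrel a ha; linarith
  -- it suffices to bound the complement
  suffices hmain : μ.real (openConn o b)ᶜ < ε by
    rw [probReal_compl_eq_one_sub MeasurableSet.of_discrete] at hmain; linarith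
  by_cases ho : o ∈ A
  · have := hrel' o ho; linarith
  -- o ∉ A: split the bad event
  set P := pocketSel A o with hPdef
  set L := liveSel b with hLdef
  have hP := mem_pocketSel A o
  have hL := mem_liveSel b
  set Bad : Set (Set (Sym2 (Fin n))) :=
    {ω | ω ∉ openConn o b ∧ ∃ a ∈ A, ω ∈ openConn o a} with hBad
  set Ssmall : ℕ → Set (Set (Sym2 (Fin n))) := fun k =>
    {ω | ω ∉ openConn o b ∧ (∃ a ∈ A, ω ∈ openConn o a) ∧ (P ω).card = k} with hSsmall
  set Sbuf : Set (Set (Sym2 (Fin n))) :=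
    {ω | ω ∉ openConn o b ∧ (∃ a ∈ A, ω ∈ openConn o a) ∧
      θ ≤ ∏ e ∈ L (P ω) ω, (1 - (w e : ℝ))} with hSbuf
  set Sres : Set (Set (Sym2 (Fin n))) :=
    {ω | ω ∉ openConn o b ∧ (∃ a ∈ A, ω ∈ openConn o a) ∧
      ∏ e ∈ L (P ω) ω, (1 - (w e : ℝ)) < θ ∧ K < (P ω).card} with hSres
  have hcover : (openConn o b)ᶜ ⊆
      (⋃ a ∈ A, openConn o a)ᶜ ∪ ((⋃ k ∈ Finset.range (K + 1), Ssmall k) ∪ (Sbuf ∪ Sres)) := by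
    intro ω hω
    by_cases hU : ω ∈ ⋃ a ∈ A, openConn o a
    · right
      have hA : ∃ a ∈ A, ω ∈ openConn o a := by
        simpa only [mem_iUnion, exists_prop] using hU
      by_cases hk : (P ω).card ≤ K
      · left
        exact mem_iUnion₂.2 ⟨(P ω).card, Finset.mem_range.2 (Nat.lt_succ_of_le hk), hω, hA, rfl⟩
      · right
        by_cases hθ' : θ ≤ ∏ e ∈ L (P ω) ω, (1 - (w e : ℝ))
        · left; exact ⟨hω, hA, hθ'⟩
        · right; exact ⟨hω, hA, lt_of_not_ge hθ', lt_of_not_ge hk⟩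
    · left; exact hU
  -- the four costs
  have h1 : μ.real (⋃ k ∈ Finset.range (K + 1), Ssmall k) ≤ δ ^ ((1 : ℝ) / 2) * D := by
    calc μ.real (⋃ k ∈ Finset.range (K + 1), Ssmall k)
        ≤ ∑ k ∈ Finset.range (K + 1), μ.real (Ssmall k) := measureReal_biUnion_finset_le _ _
      _ ≤ ∑ k ∈ Finset.range (K + 1), δ ^ ((1 : ℝ) / 2) / (1 - 1 / 2) ^ (k - 1) * (k : ℝ) ^ k := by
          refine Finset.sum_le_sum fun k _ => ?_
          exact stub_smallPockets n w A o b ho δ (1 / 2) hδ0 (by norm_num) (by norm_num) k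
            hrel' P hP
      _ = δ ^ ((1 : ℝ) / 2) * D := by
          rw [hD, Finset.mul_sum]
          refine Finset.sum_congr rfl fun k _ => ?_
          norm_num
          ring
  have h2 : μ.real Sbuf ≤ δ / θ :=
    Theorems.liveSeal_exposureBound n w A o b ho δ θ hδ0 hθ hrel' P hP L hL
  have h3 : μ.real Sres ≤ ε / 4 := hres n w A o b ho P L hP hL (hoA'.trans hδ1) fun a ha =>
    (hrel' a ha).trans hδ1
  -- numerical bookkeeping
  have hsqrt : δ ^ ((1 : ℝ) / 2) ≤ c := by
    have : δ ^ ((1 : ℝ) / 2) ≤ (c ^ 2) ^ ((1 : ℝ) / 2) :=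
      Real.rpow_le_rpow hδ0 hδ4 (by norm_num)
    refine this.trans_eq ?_
    rw [← Real.sqrt_eq_rpow, Real.sqrt_sq hc0.le]
  have h1' : δ ^ ((1 : ℝ) / 2) * D ≤ ε / 8 := by
    calc δ ^ ((1 : ℝ) / 2) * D ≤ c * D := mul_le_mul_of_nonneg_right hsqrt hD0
      _ = ε / 8 * (D / (D + 1)) := by rw [hc]; field_simp
      _ ≤ ε / 8 * 1 := by
          refine mul_le_mul_of_nonneg_left ?_ (by positivity)
          rw [div_le_one (by positivity)]; linarith
      _ = ε / 8 := mul_one _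
  have h2' : δ / θ ≤ ε / 8 := by
    rw [div_le_iff₀ hθ]; linarith
  calc μ.real (openConn o b)ᶜ
      ≤ μ.real ((⋃ a ∈ A, openConn o a)ᶜ ∪ ((⋃ k ∈ Finset.range (K + 1), Ssmall k) ∪ (Sbuf ∪ Sres))) :=
        measureReal_mono hcover (measure_ne_top _ _)
    _ ≤ μ.real (⋃ a ∈ A, openConn o a)ᶜ + (μ.real (⋃ k ∈ Finset.range (K + 1), Ssmall k) +
          (μ.real Sbuf + μ.real Sres)) := by
        refine (measureReal_union_le _ _).trans ?_
        gcongr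
        refine (measureReal_union_le _ _).trans ?_
        gcongr
        exact measureReal_union_le _ _
    _ ≤ δ + (ε / 8 + (ε / 8 + ε / 4)) := by gcongr <;> linarith
    _ < ε := by linarith

/-- **Sanity converse: the residual is not a strengthening.**  `NearOneGluing` implies the residual
stub (the residual event lies inside `{o ↮ b}`), so the residual is crux-EQUIVALENT given the
landed pieces. -/
theorem exposedLargePocketsRare_of_nearOneGluing (h : NearOneGluing) : ∀ ε : ℝ, 0 < ε → ∃ θ : ℝ, 0 < θ ∧ ∃ K : ℕ, ∃ δ : ℝ, 0 < δ ∧ ∀ (n : ℕ) (w : Sym2 (Fin n) → unitInterval) (A : Finset (Fin n)) (o b : Fin n), o ∉ A → ∀ (P : Set (Sym2 (Fin n)) → Finset (Fin n)) (L : Finset (Fin n) → Set (Sym2 (Fin n)) → Finset (Sym2 (Fin n))), (∀ ω v, v ∈ P ω ↔ ω ∈ openConnIn ((↑A : Set (Fin n))ᶜ) o v) → (∀ T ω e, e ∈ L T ω ↔ ∃ x ∈ T, ∃ y ∉ T, e = s(x, y) ∧ ω ∈ openConnIn ((↑T : Set (Fin n))ᶜ) y b) → (prodBernoulli w).real (⋃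 a ∈ A, openConn o a)ᶜ ≤ δ → (∀ a ∈ A, (prodBernoulli w).real (openConn a b)ᶜ ≤ δ) → (prodBernoulli w).real {ω | ω ∉ openConn o b ∧ (∃ a ∈ A, ω ∈ openConn o a) ∧ ∏ e ∈ L (P ω) ω, (1 - (w e : ℝ)) < θ ∧ K < (P ω).card} ≤ ε := by
  intro ε hε
  obtain ⟨δ, hδ, hN⟩ := h ε hε
  refine ⟨1, one_pos, 0, δ / 2, by positivity, ?_⟩
  intro n w A o b _ P L _ _ hoA hrel
  set μ := prodBernoulli w with hμ
  have hoA' : 1 - δ < μ.real (⋃ a ∈ A, openConn o a) := by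
    rw [probReal_compl_eq_one_sub MeasurableSet.of_discrete] at hoA; linarith
  have hrel' : ∀ a ∈ A, 1 - δ < μ.real (openConn a b) := by
    intro a ha
    have := hrel a ha
    rw [probReal_compl_eq_one_sub MeasurableSet.of_discrete] at this; linarith
  have hc := hN n w A o b hoA' hrel'
  have hcompl : μ.real (openConn o b)ᶜ < ε := by
    rw [probReal_compl_eq_one_sub MeasurableSet.of_discrete]; linarith
  refine le_of_lt (lt_of_le_of_lt ?_ hcompl)
  exact measureReal_mono (fun ω hω => hω.1) (measure_ne_top _ _)

end Summit.CriticalPhenomena.PercolationContinuityZ3.Cruxes.NearOneGluing.LiveSeal
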